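import Mathlib
import HarnessLib
import Summits.ResolutionOfSingularities.ResolutionOfSingularities.Theorems.WildQuotientsWildQuotientResolutionConductorOnePresentationInvariance

/-!
# S2 F5b (part 3b): CLAIM P — the invariant ring of the straightened chart is the localised cone
(crux stmt-ResolutionOfSingularities-15640 `WildQuotients.WildQuotientResolution`, line `Sketch`;
chain w45c post-V5 programme S2, design `L/res-L1-w45c-lead-1/S2-DESIGN.md` v1.1 §7 (7.2)/(7.7),
res-L1-w45c-plan-1 RULINGs 2026-08-27T16:27:51Z (F5 = lead-1), 17:07:17Z (R2)/(R4), 17:31:45Z (3).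
[OURS · L1 W4.5c] — NOT a statement of the manuscript. Lead prover res-L1-w45c-lead-1.)

For the straightened chart ring `M = ChartRing k p n i I` (`i ∈ I`) and ANY `k`-algebra endomorphism
`σ` with the diagonal-Möbius laws (`IsChartAction`), `R₀ = ↥(PthCone.cone k n p (chartWeight p n I))`,
`ν = ConductorOne.coneNu`:

* **`ConductorOne.psi`** `: Localization.Away ν →ₐ[k] M` (extends `ψ₀`), `sigma_psi`,
  `exists_psi_eq_of_fixed` (the heart `mem_span_chartMono_of_fixed`), **`mem_range_psi_iff`**
  (`x ∈ range ψ ↔ σ x = x`): CLAIM P `M^σ = R₀[1/ν]`;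
* **`psi0_injective`**, **`psi_injective`** (lowest `xᵢ`-degree on the support);
* `chartOrigin_ne_top`, **`comap_chartOrigin_psi0`** (`ψ₀⁻¹(𝔪_Q) = PthCone.irrelevant`);
* **`ConductorOne.presentation`** — the presentation brick `HP` of the S2 scaffold in one statement.
-/

-- single-problem summit: the doubled namespace component `ResolutionOfSingularities` is forced
set_option linter.dupNamespace false

noncomputable section

open MvPolynomial

namespace Summit.ResolutionOfSingularities.ResolutionOfSingularities.Theorems.WildQuotientResolution.ConductorOne

section Presentation

variable (k : Type) [Field k] (p n : ℕ) (i : Fin n) (I : Finset (Fin n))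
variable [Fact p.Prime] [CharP k p]
variable (σ : ChartRing k p n i I →ₐ[k] ChartRing k p n i I)
  (hσ : IsChartAction k p n i I (σ : ChartRing k p n i I →+* ChartRing k p n i I))

/-! ## `ψ` on the localisation, its range and injectivity -/

/-- **The presentation map** `ψ : R₀[1/ν] → M`. [OURS · L1 W4.5c] -/
def psi (hi : i ∈ I) : Localization.Away (coneNu k p n i I hi) →ₐ[k] ChartRing k p n i I :=
  { IsLocalization.Away.lift (coneNu k p n i I hi) (g := (psi0 k p n i I : _ →+* _))
      (isUnit_psi0_coneNu k p n i I hi) with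
    commutes' := fun r => by
      have h1 : algebraMap k (Localization.Away (coneNu k p n i I hi)) r =
          algebraMap (PthCone.cone k n p (chartWeight p n I)) (Localization.Away (coneNu k p n i I hi))
            (algebraMap k (PthCone.cone k n p (chartWeight p n I)) r) :=
        IsScalarTower.algebraMap_apply k _ _ r
      simp only [RingHom.toMonoidHom_eq_coe, OneHom.toFun_eq_coe, MonoidHom.toOneHom_coe,
        MonoidHom.coe_coe]
      rw [h1, IsLocalization.Away.lift_eq]
      exact (psi0 k p n i I).commutes r }

/-- `ψ` extends `ψ₀`. [OURS · L1 W4.5c] -/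
theorem psi_algebraMap (hi : i ∈ I) (a : PthCone.cone k n p (chartWeight p n I)) :
    psi k p n i I hi (algebraMap _ (Localization.Away (coneNu k p n i I hi)) a) = psi0 k p n i I a :=
  IsLocalization.Away.lift_eq (coneNu k p n i I hi) (isUnit_psi0_coneNu k p n i I hi) a

include hσ in
/-- **Range of `ψ` ⊆ fixed points.** [OURS · L1 W4.5c] -/
theorem sigma_psi (hi : i ∈ I) (z : Localization.Away (coneNu k p n i I hi)) :
    σ (psi k p n i I hi z) = psi k p n i I hi z := by
  haveI := chartRing_isDomain k p n i I
  obtain ⟨⟨a, ⟨_, ⟨r, rfl⟩⟩⟩, hz⟩ := IsLocalization.surj (Submonoid.powers (coneNu k p n i I hi)) z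
  simp only at hz
  -- `ψ z * N'^r = ψ₀ a`
  have h1 : psi k p n i I hi z * chartNu k p n i I ^ r = psi0 k p n i I a := by
    rw [← psi0_coneNu k p n i I hi, ← map_pow, ← psi_algebraMap k p n i I hi, ← psi_algebraMap k p n i I hi,
      ← map_mul, hz]
  have h2 : σ (psi k p n i I hi z) * chartNu k p n i I ^ r = psi k p n i I hi z * chartNu k p n i I ^ r := by
    rw [h1, ← sigma_chartNu k p n i I σ hσ, ← map_pow, ← map_mul, h1, sigma_psi0 k p n i I σ hσ]
  exact ((isUnit_chartNu k p n i I).pow r).mul_left_injective h2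

include hσ in
/-- **Fixed points ⊆ range of `ψ`** (the heart: `mem_span_chartMono_of_fixed`). [OURS · L1 W4.5c] -/
theorem exists_psi_eq_of_fixed (hi : i ∈ I) (x : ChartRing k p n i I) (hx : σ x = x) :
    ∃ z, psi k p n i I hi z = x := by
  obtain ⟨r, hr⟩ := mem_span_chartMono_of_fixed k p n i I σ hσ hi x hx
  -- the span of the cone-monomial images lies in the range of `ψ₀`
  have hle : Submodule.span k (Set.range (chartMono k p n i I :
      Multiplicative (coneMonoid n p (chartWeight p n I)) → ChartRing k p n i I)) ≤
      Subalgebra.toSubmodule (psi0 k p n i I).range := by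
    rw [Submodule.span_le]
    rintro _ ⟨m, rfl⟩
    have hm := (mem_coneMonoid_iff n p _ m.toAdd.1).mp m.toAdd.2
    refine ⟨coneMonomial k n p _ m.toAdd.1 hm, ?_⟩
    change psi0 k p n i I (coneMonomial k n p _ m.toAdd.1 hm) = _
    rw [psi0_coneMonomial, chartMono_apply]
  obtain ⟨g, hg⟩ := hle hr
  change psi0 k p n i I g = _ at hg
  -- `x = ψ (g · invSelf^r)`
  refine ⟨algebraMap _ _ g * (IsLocalization.Away.invSelf (coneNu k p n i I hi)) ^ r, ?_⟩
  have hinv : psi k p n i I hi (IsLocalization.Away.invSelf (coneNu k p n i I hi)) * chartNu k p n i I = 1 := by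
    rw [← psi0_coneNu k p n i I hi, ← psi_algebraMap k p n i I hi, ← map_mul, mul_comm,
      IsLocalization.Away.mul_invSelf, map_one]
  rw [map_mul, map_pow, psi_algebraMap, hg]
  calc x * chartNu k p n i I ^ r * psi k p n i I hi (IsLocalization.Away.invSelf (coneNu k p n i I hi)) ^ r
      = x * (psi k p n i I hi (IsLocalization.Away.invSelf (coneNu k p n i I hi)) * chartNu k p n i I) ^ r := by
        rw [mul_pow]; ring
    _ = x := by rw [hinv, one_pow, mul_one]

include hσ in
/-- **CLAIM P, range form**: `x ∈ range ψ ↔ σ x = x`. [OURS · L1 W4.5c] -/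
theorem mem_range_psi_iff (hi : i ∈ I) (x : ChartRing k p n i I) :
    x ∈ Set.range (psi k p n i I hi) ↔ σ x = x := by
  constructor
  · rintro ⟨z, rfl⟩; exact sigma_psi k p n i I σ hσ hi z
  · intro hx; exact exists_psi_eq_of_fixed k p n i I σ hσ hi x hx

/-! ## Injectivity -/

omit [CharP k p] in
/-- **`ψ₀` is injective** (lowest `xᵢ`-degree argument on the support). [OURS · L1 W4.5c] -/
theorem psi0_injective : Function.Injective (psi0 k p n i I) := by
  classical
  rw [injective_iff_map_eq_zero]
  intro f hf
  by_contra hne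
  have hF : (f : MvPolynomial (Fin n) k) ≠ 0 := fun h => hne (Subtype.ext h)
  set F : MvPolynomial (Fin n) k := (f : MvPolynomial (Fin n) k) with hFdef
  have hS : F.support.Nonempty := support_nonempty.mpr hF
  obtain ⟨d₀, hd₀S, hmin⟩ := Finset.exists_min_image F.support (fun d => d i) hS
  -- clear the unit powers: multiply `ψ₀ f = 0` by `U^E`
  set E : ℕ := F.support.sup (fun d => (coneDeg n p I d).toNat) with hE
  have hEge : ∀ d ∈ F.support, coneDeg n p I d ≤ E := fun d hd =>
    (Int.self_le_toNat _).trans (by exact_mod_cast Finset.le_sup (f := fun d => (coneDeg n p I d).toNat) hd)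
  have hsum := psi0_eq_sum k p n i I f
  rw [hf] at hsum
  have hsum' : ∑ d ∈ F.support, algebraMap (MvPolynomial (Fin n) k) (ChartRing k p n i I)
      (monomial d (coeff d F) * (1 - X i ^ (p - 1)) ^ ((E : ℤ) - coneDeg n p I d).toNat) = 0 := by
    have h := congrArg (· * ((chartUUnit k p n i I ^ (E : ℤ) : (ChartRing k p n i I)ˣ) : ChartRing k p n i I)) hsum.symm
    simp only [zero_mul, Finset.sum_mul] at h
    rw [← h]
    refine Finset.sum_congr rfl fun d hd => ?_
    rw [map_mul, mul_assoc, ← Units.val_mul, ← zpow_add, map_pow, map_sub, map_one, map_pow,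
      show -coneDeg n p I d + (E : ℤ) = (((E : ℤ) - coneDeg n p I d).toNat : ℕ) by
        rw [Int.toNat_of_nonneg (by linarith [hEge d hd])]; ring,
      val_chartUUnit_zpow_natCast]
  -- hence a polynomial identity in `k[x]`
  have hG : ∑ d ∈ F.support, monomial d (coeff d F) *
      Polynomial.aeval (X i) (((1 : Polynomial k) - Polynomial.X ^ (p - 1)) ^ ((E : ℤ) - coneDeg n p I d).toNat) =
        (0 : MvPolynomial (Fin n) k) := by
    apply chart_algebraMap_injective k p n i I
    rw [map_sum, map_zero, ← hsum']
    refine Finset.sum_congr rfl fun d _ => ?_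
    rw [map_mul, map_mul, algebraMap_aeval_X, map_pow, map_sub, map_one, map_pow, Polynomial.aeval_X,
      map_pow, map_sub, map_one, map_pow]
  -- read off the coefficient of `x^{d₀}`
  have hcoeff := congrArg (coeff d₀) hG
  rw [coeff_sum, coeff_zero] at hcoeff
  rw [Finset.sum_eq_single d₀] at hcoeff
  · rw [coeff_monomial_mul', if_pos le_rfl, tsub_self, coeff_aeval_X] at hcoeff
    simp only [Finsupp.coe_zero, Pi.zero_apply, Finsupp.single_zero, ↓reduceIte] at hcoeff
    have h0 : (((1 : Polynomial k) - Polynomial.X ^ (p - 1)) ^ ((E : ℤ) - coneDeg n p I d₀).toNat).coeff 0 = 1 := by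
      have hp : p - 1 ≠ 0 := by have := (Fact.out : p.Prime).two_le; omega
      rw [Polynomial.coeff_zero_eq_eval_zero, Polynomial.eval_pow, Polynomial.eval_sub, Polynomial.eval_one,
        Polynomial.eval_pow, Polynomial.eval_X, zero_pow hp, sub_zero, one_pow]
    rw [h0, mul_one] at hcoeff
    exact (mem_support_iff.mp hd₀S) hcoeff
  · intro d hd hne'
    rw [coeff_monomial_mul']
    split_ifs with hle
    · rw [coeff_aeval_X]
      split_ifs with hsingle
      · exfalso
        apply hne'
        -- `d ≤ d₀`, `d₀ - d` supported at `i`, and minimality force `d = d₀`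
        have hdi : d₀ i ≤ d i := hmin d hd
        ext l
        by_cases hl : l = i
        · subst hl; exact le_antisymm (hle l) hdi
        · have h1 : (d₀ - d) l = 0 := by
            rw [hsingle, Finsupp.single_apply, if_neg (fun h => hl h.symm)]
          rw [Finsupp.tsub_apply] at h1
          have h2 : d l ≤ d₀ l := hle l
          omega
      · rw [mul_zero]
    · rfl
  · intro h; exact absurd hd₀S h

/-- **`ψ` is injective.** [OURS · L1 W4.5c] -/
theorem psi_injective (hi : i ∈ I) : Function.Injective (psi k p n i I hi) := by
  rw [injective_iff_map_eq_zero]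
  intro z hz
  obtain ⟨⟨a, ⟨_, ⟨r, rfl⟩⟩⟩, hz'⟩ := IsLocalization.surj (Submonoid.powers (coneNu k p n i I hi)) z
  simp only at hz'
  have ha : psi0 k p n i I a = 0 := by
    rw [← psi_algebraMap k p n i I hi, ← hz', map_mul, hz, zero_mul]
  have ha0 : a = 0 := psi0_injective k p n i I (by rw [ha, map_zero])
  rw [ha0, map_zero] at hz'
  have hu : IsUnit (algebraMap (PthCone.cone k n p (chartWeight p n I))
      (Localization.Away (coneNu k p n i I hi)) (coneNu k p n i I hi ^ r)) := by
    rw [map_pow]; exact (IsLocalization.Away.algebraMap_isUnit (coneNu k p n i I hi)).pow r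
  exact (hu.mul_left_eq_zero).mp hz'

/-! ## The point ideal pulls back to the irrelevant ideal -/

omit [CharP k p] in
/-- The point ideal `𝔪_Q` is proper (evaluation at the origin kills it). [OURS · L1 W4.5c] -/
theorem chartOrigin_ne_top : chartOrigin k p n i I ≠ ⊤ := by
  -- evaluation at `0` extends to `M` since `h_M(0) = 1`
  have hp : p - 1 ≠ 0 := by have := (Fact.out : p.Prime).two_le; omega
  have hval : MvPolynomial.eval (fun _ : Fin n => (0 : k)) (chartDen k p n i I) = 1 := by
    unfold chartDen
    simp only [map_mul, map_sub, map_one, map_pow, map_add, map_prod, MvPolynomial.eval_X,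
      zero_pow hp, sub_zero, mul_zero, add_zero, one_pow, mul_one, Finset.prod_const_one]
  have hunit : IsUnit ((MvPolynomial.eval fun _ : Fin n => (0 : k)) (chartDen k p n i I)) := by
    rw [hval]; exact isUnit_one
  let φ : ChartRing k p n i I →+* k := IsLocalization.Away.lift (chartDen k p n i I) hunit
  intro htop
  have h1 : (1 : ChartRing k p n i I) ∈ chartOrigin k p n i I := by rw [htop]; trivial
  have hle : chartOrigin k p n i I ≤ RingHom.ker φ := by
    rw [chartOrigin, Ideal.span_le]
    rintro _ ⟨l, rfl⟩
    rw [SetLike.mem_coe, RingHom.mem_ker, chartX, IsLocalization.Away.lift_eq, MvPolynomial.eval_X]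
  have := hle h1
  rw [RingHom.mem_ker, map_one] at this
  exact one_ne_zero this

omit [CharP k p] in
/-- **`ψ₀⁻¹(𝔪_Q) = irrelevant`** (plan-1 17:31:45Z (3)). [OURS · L1 W4.5c] -/
theorem comap_chartOrigin_psi0 :
    Ideal.comap (psi0 k p n i I) (chartOrigin k p n i I) = PthCone.irrelevant k n p (chartWeight p n I) := by
  classical
  -- `⊇`: non-constant monomials map into `(x_l)`
  have hsub : PthCone.irrelevant k n p (chartWeight p n I) ≤ Ideal.comap (psi0 k p n i I) (chartOrigin k p n i I) := by
    intro f hf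
    rw [Ideal.mem_comap, psi0_eq_sum]
    refine Ideal.sum_mem _ fun d hd => Ideal.mul_mem_right _ _ ?_
    have hd0 : d ≠ 0 := by
      intro h
      rw [h] at hd
      rw [PthCone.mem_irrelevant_iff] at hf
      exact (mem_support_iff.mp hd) (by rw [← constantCoeff_eq, hf])
    obtain ⟨l, hl⟩ := Finsupp.ne_iff.mp hd0
    have hd' : d = Finsupp.single l 1 + (d - Finsupp.single l 1) := by
      ext l'
      rw [Finsupp.add_apply, Finsupp.tsub_apply, Finsupp.single_apply]
      simp only [Finsupp.coe_zero, Pi.zero_apply, ne_eq] at hl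
      split_ifs with h
      · subst h; omega
      · omega
    have hsplit : monomial d (coeff d (f : MvPolynomial (Fin n) k)) =
        X l * monomial (d - Finsupp.single l 1) (coeff d (f : MvPolynomial (Fin n) k)) := by
      rw [X, monomial_mul, one_mul, ← hd']
    rw [hsplit, map_mul]
    exact Ideal.mul_mem_right _ _ (chartX_mem_chartOrigin k p n i I l)
  refine le_antisymm ?_ hsub
  intro f hf
  rw [Ideal.mem_comap] at hf
  -- split off the constant term
  set c : k := constantCoeff (f : MvPolynomial (Fin n) k) with hc
  have hf' : f - algebraMap k _ c ∈ PthCone.irrelevant k n p (chartWeight p n I) := by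
    rw [PthCone.mem_irrelevant_iff, Subalgebra.coe_sub, Subalgebra.coe_algebraMap, map_sub,
      MvPolynomial.algebraMap_eq, constantCoeff_C, hc, sub_self]
  have h2 : psi0 k p n i I (algebraMap k _ c) ∈ chartOrigin k p n i I := by
    have := (chartOrigin k p n i I).sub_mem hf (hsub hf')
    rwa [map_sub, sub_sub_cancel] at this
  rw [AlgHom.commutes] at h2
  by_cases hc0 : c = 0
  · rw [PthCone.mem_irrelevant_iff, ← hc, hc0]
  · exfalso
    apply chartOrigin_ne_top k p n i I
    exact Ideal.eq_top_of_isUnit_mem _ h2 ((IsUnit.mk0 c hc0).map _)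

/-! ## The presentation brick in the shape consumed by the scaffold -/

include hσ in
/-- **CLAIM P (S2-DESIGN (7.7), the presentation brick `HP` of the scaffold)**: for the
straightened chart ring with a `k`-algebra endomorphism satisfying the diagonal-Möbius laws, the
invariants are the localised weight-`0` cone: there are `ν ∈ R₀` and
`ψ : R₀[1/ν] → M` injective with range `{x | σ x = x}`, extending the monomial presentation `ψ₀`,
whose point-ideal pull-back is the irrelevant ideal. [OURS · L1 W4.5c] -/
theorem presentation (hi : i ∈ I) :
    ∃ (ν : PthCone.cone k n p (chartWeight p n I))
      (ψ : Localization.Away ν →ₐ[k] ChartRing k p n i I),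
      Function.Injective ψ ∧ (∀ x, x ∈ Set.range ψ ↔ σ x = x) ∧
      (∀ a, ψ (algebraMap _ _ a) = psi0 k p n i I a) ∧
      (Ideal.comap ψ (chartOrigin k p n i I)).comap
          (algebraMap (PthCone.cone k n p (chartWeight p n I)) (Localization.Away ν)) =
        PthCone.irrelevant k n p (chartWeight p n I) :=
  ⟨coneNu k p n i I hi, psi k p n i I hi, psi_injective k p n i I hi,
    mem_range_psi_iff k p n i I σ hσ hi, psi_algebraMap k p n i I hi, by
      ext a
      rw [Ideal.mem_comap, Ideal.mem_comap, psi_algebraMap, ← comap_chartOrigin_psi0 k p n i I,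
        Ideal.mem_comap]⟩

end Presentation

end Summit.ResolutionOfSingularities.ResolutionOfSingularities.Theorems.WildQuotientResolution.ConductorOne

end
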